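import Literature.AlgebraicGeometry.Resolution.Kuhlmann2019DegreePStepSplit
import Literature.AlgebraicGeometry.Resolution.KuhlmannVlahuThm111
import Literature.AlgebraicGeometry.Resolution.Kuhlmann2019Prop52FirstSteps
import HarnessLib

/-!
# Henselian rationality over a perfect henselian ground field of rank one without tame extensions

Topic: `Literature/AlgebraicGeometry/Resolution` (valued function fields). PROVED: the
valuation-theoretic content of M. Temkin, *Inseparable local uniformization*, J. Algebra 373
(2013) = arXiv:0804.1554, **Thm. 3.2.3** in the case "`K` is `k`-split and `k = k^{mr}`" (its
starting point, [temst] = M. Temkin, *Stable modification of relative curves*, J. Algebraic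
Geom. 19 (2010), Thm. 6.3.1 under Assumption 6.2.1 (ii): "`K` is of type 4 and `k`-split,
`k = k^{mr}`, and … `k` is deeply ramified"), rendered in henselizations and proved along the
architecture of F.-V. Kuhlmann, *Elimination of ramification II: Henselian rationality*,
Israel J. Math. 234 (2019) = arXiv:1701.05508, **Prop. 5.2** (there for separably closed ground
fields; tree: `Kuhlmann2019_Prop52_sepClosed_holds`):

* ground field `K ≤ Ω`: perfect (= deeply ramified in equal characteristic), henselian, of rank
  one, with divisible value group and algebraically closed residue field (= `K` has no proper
  tame extension, "`k = k^{mr}`" for a deeply ramified `k`, [temst] Remark 6.2.2);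
* function field `F ≥ K`: finitely and separably generated of transcendence degree `1`,
  `(F|K, V)` immediate ("type 4"), and `K` algebraically closed in `F^h` (`K`-split,
  Temkin 2013, Cor. 3.1.10);
* conclusion: `F ≤ K(x)^h` for some `x ∈ F` transcendental over `K` — `(F|K, V)` is henselian
  rational ("`K = \overline{k(T)}`").

The three uses of separable closedness in the printed proof of Prop. 5.2 and its lemmas are
replaced as documented in `Kuhlmann2019DegreePStepSplit.lean` (transcendental approximation
type from splitness, density from perfectness, the constant Artin–Schreier case from
splitness); Lemma 5.1 (towers of Galois steps of degree `p`) uses exactly "no tame extensions"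
(`isNormalPTower_of_isSeparable_of_divisible`); [23, Thm. 11.1] (Kuhlmann–Vlahu) is re-run
with splitness (`kuhlmannVlahu_thm111_of_perfect`).

## Content (everything PROVED; no definitions, no named facts)

* `exists_eq_henselization_of_isNormalPTower_of_le` — the induction of the proof of Prop. 5.2
  with the degree-`p` step relative to an ambient `Φ` [cite: Kuhlmann2019, Prop. 5.2 (proof)].
* `kuhlmannVlahu_thm111_of_perfect` — [23, Thm. 11.1] as used in Prop. 5.2, over a perfect
  henselian `K` algebraically closed in `F^h` [cite: Kuhlmann2019, Prop. 5.2 (proof)]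
  [cite: KuhlmannVlahu2014, Thm. 11.1].
* `henselianRational_of_perfect_of_forall_isAlgebraic_mem` — **henselian rationality over a
  perfect henselian rank-one ground field without tame extensions, for split immediate function
  fields of transcendence degree one** [cite: Kuhlmann2019, Prop. 5.2]
  [cite: Temkin2013, Thm. 3.2.3].

## Sources

* F.-V. Kuhlmann, Israel J. Math. 234 (2019) = arXiv:1701.05508: Lemma 5.1, Prop. 5.2 and its
  proof (p. 12), Lemma 5.4, §4. [Kuhlmann2019]
* F.-V. Kuhlmann, I. Vlahu, Math. Z. 276 (2014) = arXiv:1304.0200: Thm. 11.1. [KuhlmannVlahu2014]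
* M. Temkin, J. Algebra 373 (2013) = arXiv:0804.1554: Cor. 3.1.10, Thm. 3.2.3 and its proof
  (p. 24 of the held arXiv text). [Temkin2013]
* M. Temkin, J. Algebraic Geom. 19 (2010) = arXiv:0707.3953: Assumption 6.2.1, Remark 6.2.2,
  Thm. 6.3.1 (pp. 32, 37–38 of the arXiv text).

## Rendering notes

As in `Kuhlmann2019Prop52Reduction.lean` / `KuhlmannVlahuThm111.lean` (ambient `(Ω, V)`
algebraically closed of characteristic `p`, `K(x) = Subfield.closure (K ∪ {x})`,
`K(x)^h = henselization V K(x)`, `IsImmediateOver`, `IsRankOne`, `FGOver`,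
`SeparablyGeneratedOver`; "divisible value group" as `hdiv`, "algebraically closed residue
field" as `IsAlgClosed (resField V K)`, "perfect" as `hperf`, "`K` algebraically closed in `F^h`"
as `hrel`).
-/

noncomputable section

namespace Literature.AlgebraicGeometry.Resolution

universe u

open Polynomial IsLocalRing IntermediateField

variable {Ω : Type u} [Field Ω] (V : ValuationSubring Ω)

/-! ### The induction along the tower, inside a fixed `Φ` -/

section Induction

/-- **The induction in the proof of Kuhlmann 2019, Prop. 5.2, relative to an ambient `Φ`** —
`exists_eq_henselization_of_isNormalPTower` (`Kuhlmann2019Prop52Reduction.lean`) with the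
degree-`p` step `(hstep)` allowed to depend on the position of the step inside a fixed subfield
`Φ` (immediate over `K`; in the application `Φ = F^h`, in which `K` is algebraically closed):
if `T ≤ Φ` is reached from `M = K(y)^h` (`y ∈ Φ` transcendental over `K`) by a finite tower of
normal extensions of degree `p` and every element of `T` is separable over `M`, then
`T = K(y')^h` for some `y' ∈ T` transcendental over `K`. Same proof.
[cite: Kuhlmann2019, Prop. 5.2 (proof)] -/
theorem exists_eq_henselization_of_isNormalPTower_of_le {p : ℕ} {K Φ : Subfield Ω}
    (hstep : ∀ (y : Ω) (E : Subfield Ω), Transcendental K y →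
      IsImmediateOver V K (Subfield.closure ((K : Set Ω) ∪ {y})) → y ∈ Φ →
      IsGaloisStep p (henselization V (Subfield.closure ((K : Set Ω) ∪ {y}))) E → E ≤ Φ →
      ∃ ϑ ∈ E, E = henselization V (Subfield.closure ((K : Set Ω) ∪ {ϑ})))
    (himmΦ : IsImmediateOver V K Φ) {M T : Subfield Ω} (htower : IsNormalPTower p M T) :
    ∀ y : Ω, Transcendental K y → y ∈ Φ →
      M = henselization V (Subfield.closure ((K : Set Ω) ∪ {y})) →
      T ≤ Φ → (∀ z ∈ T, IsSeparable M z) →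
      ∃ y' ∈ T, Transcendental K y' ∧
        T = henselization V (Subfield.closure ((K : Set Ω) ∪ {y'})) := by
  induction htower with
  | refl M =>
    intro y hy _ hM _ _
    refine ⟨y, ?_, hy, hM⟩
    rw [hM]
    exact le_henselization V _ (Subfield.subset_closure (Or.inr rfl))
  | @step M M₁ T hMM₁ hM₁T ih =>
    intro y hy hyΦ hM hTΦ hsepT
    have hle : M ≤ M₁ := hMM₁.le
    have hle₁ : M₁ ≤ T := hM₁T.le
    -- the first step is Galois
    have hgal : IsGaloisStep p M M₁ :=
      isGaloisStep_of_isNormalStep_of_forall_isSeparable hMM₁ fun z hz => hsepT z (hle₁ hz)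
    -- `K(y) ≤ M ≤ M₁ ≤ T ≤ Φ` is immediate over `K`
    have hKyM : Subfield.closure ((K : Set Ω) ∪ {y}) ≤ M := hM ▸ le_henselization V _
    have himmy : IsImmediateOver V K (Subfield.closure ((K : Set Ω) ∪ {y})) :=
      himmΦ.mono_right (hKyM.trans (hle.trans (hle₁.trans hTΦ)))
    rw [hM] at hgal
    obtain ⟨ϑ, hϑM₁, hM₁⟩ := hstep y M₁ hy himmy hyΦ hgal (hle₁.trans hTΦ)
    -- `ϑ` is transcendental over `K`: `y ∈ K(ϑ)^h` is algebraic over `K(ϑ)`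
    have hϑ : Transcendental K ϑ := by
      intro hϑalg
      apply hy
      have hyM₁ : y ∈ henselization V (Subfield.closure ((K : Set Ω) ∪ {ϑ})) :=
        hM₁ ▸ hle (hKyM (Subfield.subset_closure (Or.inr rfl)))
      have h1 : IsAlgebraic (Subfield.closure ((K : Set Ω) ∪ {ϑ})) y :=
        (isSeparable_of_mem_henselization V _ hyM₁).isIntegral.isAlgebraic
      refine isAlgebraic_trans_subfield (K := K) (fun c hc => Subfield.subset_closure (Or.inl hc))
        (fun w hw => isAlgebraic_of_mem_closure (fun x hx => ?_) hw) h1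
      rw [Set.mem_singleton_iff.mp hx]
      exact hϑalg
    have hsepM₁ : ∀ z ∈ T, IsSeparable M₁ z := fun z hz => isSeparable_of_subfield_le hle (hsepT z hz)
    exact ih ϑ hϑ (hTΦ (hle₁ hϑM₁)) hM₁ hTΦ hsepM₁

end Induction

/-! ### [23, Thm. 11.1] over a perfect ground field algebraically closed in `F^h` -/

section KV

/-- **Kuhlmann–Vlahu 2014, Thm. 11.1 as used in Kuhlmann 2019, Prop. 5.2, over a PERFECT
henselian ground field of rank one with `K` algebraically closed in `F^h`** —
`kuhlmannVlahu_thm111` (`KuhlmannVlahuThm111.lean`) with "`K` separably closed" replaced by: `K`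
perfect and henselian (characteristic `p`), and every element of `F^h` algebraic over `K` lies in
`K` (so that `F^h` is `K`-split, Temkin 2013, Cor. 3.1.10, `DeeplyRamifiedSplit.lean`, and `x`
has transcendental approximation type, `SplitApproximationType.lean`). For `F|K` finitely and
separably generated of transcendence degree `1` and immediate, and `x ∈ F^h` transcendental
over `K` with `F ≤ K(x)^h`, there is a transcendental `y ∈ F` with `F ≤ K(y)^h`. Same proof.
[cite: Kuhlmann2019, Prop. 5.2 (proof) with Thm. 2.3] [cite: Temkin2013, Thm. 3.2.3 (proof)] -/
theorem kuhlmannVlahu_thm111_of_perfect [IsAlgClosed Ω] (p : ℕ) [Fact p.Prime] [CharP Ω p]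
    [CharP (ResidueField V) p] (K F : Subfield Ω) (x : Ω)
    (hK : IsHenselianField K (V.comap (algebraMap K Ω))) (hperf : ∀ y ∈ K, ∃ b ∈ K, b ^ p = y)
    (hr : IsRankOne V K) (hKF : K ≤ F) (hfg : FGOver K F) (hsg : SeparablyGeneratedOver K F)
    (h1 : ∃ t ∈ F, Transcendental K t ∧
      ∀ z ∈ F, IsAlgebraic (IntermediateField.adjoin K ({t} : Set Ω)) z)
    (himm : IsImmediateOver V K F)
    (hrel : ∀ a ∈ henselization V F, IsAlgebraic K a → a ∈ K)
    (hxFh : x ∈ henselization V F) (hxt : Transcendental K x)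
    (hFx : F ≤ henselization V (Subfield.closure ((K : Set Ω) ∪ {x}))) :
    ∃ y ∈ F, Transcendental K y ∧
      F ≤ henselization V (Subfield.closure ((K : Set Ω) ∪ {y})) := by
  classical
  set Kx : Subfield Ω := Subfield.closure ((K : Set Ω) ∪ {x}) with hKxdef
  set Hx : Subfield Ω := henselization V Kx with hHxdef
  set Fh : Subfield Ω := henselization V F with hFhdef
  have hKKx : K ≤ Kx := fun c hc => Subfield.subset_closure (Or.inl hc)
  have hxKx : x ∈ Kx := Subfield.subset_closure (Or.inr rfl)
  have hFFh : F ≤ Fh := le_henselization V F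
  have hKxFh : Kx ≤ Fh :=
    Subfield.closure_le.mpr (Set.union_subset (hKF.trans hFFh) (Set.singleton_subset_iff.mpr hxFh))
  -- immediateness of `F^h`, `K(x)` over `K`; rank one
  have himmFh : IsImmediateOver V K Fh := himm.trans (Kuhlmann2010HenselizationImmediate_holds Ω V F)
  have himmKx : IsImmediateOver V K Kx := himmFh.mono_right hKxFh
  have hKr : IsRankOneValued V K := isRankOneValued_of_overrings V K hr.1 hr.2
  have hFr : IsRankOneValued V F := hKr.of_isImmediateOver hKF himm
  -- `x ∉ K`, immediateness data, transcendental approximation type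
  have htrans : ∀ P : Polynomial Ω, (∀ k, P.coeff k ∈ K) → P.eval x = 0 → P = 0 := by
    intro P hP hPx
    obtain ⟨P', hP'⟩ : ∃ P' : Polynomial K, P'.map (algebraMap K Ω) = P :=
      (Polynomial.mem_lifts P).mp ((Polynomial.lifts_iff_coeff_lifts P).mpr
        fun k => ⟨⟨P.coeff k, hP k⟩, rfl⟩)
    by_contra hP0
    refine hxt ⟨P', fun h => hP0 ?_, ?_⟩
    · rw [← hP', h, Polynomial.map_zero]
    · rw [Polynomial.aeval_def, ← Polynomial.eval_map, hP', hPx]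
  have hxK : x ∉ K := not_mem_of_forall_eval_eq_zero K htrans
  have hval : ∀ w ∈ Kx, w ≠ 0 → ∃ b ∈ K, V.valuation w = V.valuation b := himmKx.1
  have hres : ∀ w ∈ Kx, w ∈ V → ∃ c ∈ K, V.valuation (w - c) < 1 := by
    intro w hw hwV
    have hrw : residue V ⟨w, hwV⟩ ∈ resField V K := himmKx.2 (residue_mem_resField V ⟨w, hwV⟩ hw)
    obtain ⟨c, hcK, hcw⟩ := (mem_resField_iff V K _).mp hrw
    refine ⟨c, hcK, ?_⟩
    have h0 : residue V (⟨w, hwV⟩ - c) = 0 := by rw [map_sub, hcw, sub_self]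
    exact (ValuationSubring.valuation_lt_one_iff V (⟨w, hwV⟩ - c)).mp ((residue_eq_zero_iff _).mp h0)
  -- `F^h` is henselian and `K`-split (Temkin 2013, Cor. 3.1.10); transcendental approximation type
  have hFh : IsHenselianField Fh (V.comap (algebraMap Fh Ω)) :=
    Kuhlmann2010HenselizationIsHenselian_holds Ω V F
  have hsplit : ∀ θ g : Ω, IsAlgebraic K θ → IsAlgebraic K g →
      (∀ c ∈ K, V.valuation g ≤ V.valuation (x - c)) → V.valuation g ≤ V.valuation (x - θ) :=
    fun θ g hθ hg hfar' =>
      valuation_le_sub_of_forall_isAlgebraic_mem_of_perfect V p (hKF.trans hFFh) hK hperf hKr hFh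
        hrel hxFh hθ hg hfar'
  have h3 := kaplansky_condition_of_split V K htrans himmKx hsplit
  have hr1Kx : IsRankOneValued V Kx := hKr.of_isImmediateOver hKKx himmKx
  -- the valuation is non-trivial on `K`: some `π ∈ K^×` with `v(π) < 1`
  obtain ⟨π, hπK, hπ0, hπ1⟩ : ∃ π ∈ K, π ≠ 0 ∧ V.valuation π < 1 := by
    obtain ⟨⟨a, haK, ha⟩, -⟩ := hKr
    have ha0 : a ≠ 0 := fun h => by rw [h, map_zero] at ha; exact not_lt_zero ha
    exact ⟨a⁻¹, inv_mem haK, inv_ne_zero ha0, by rw [map_inv₀]; exact inv_lt_one_of_one_lt₀ ha⟩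
  -- a separating transcendental `z ∈ F`
  obtain ⟨z, hzF, hz, hsepz⟩ := exists_separating_of_separablyGeneratedOver hsg h1
  /- The core: for `y ∈ F` separating, transcendental, and — unless `x` is a limit of elements of
  `K` — closer to `x` than `K`, we get `F ≤ K(y)^h`. -/
  have core : ∀ y ∈ F, Transcendental K y →
      (∀ w ∈ F, IsSeparable (Subfield.closure ((K : Set Ω) ∪ {y})) w) →
      ((∀ e ∈ K, e ≠ 0 → ∃ c ∈ K, V.valuation (x - c) < V.valuation e) ∨
        ∃ e ∈ K, e ≠ 0 ∧ (∀ c ∈ K, V.valuation e ≤ V.valuation (x - c)) ∧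
          V.valuation (x - y) < V.valuation e) →
      F ≤ henselization V (Subfield.closure ((K : Set Ω) ∪ {y})) := by
    intro y hyF _hyt hsepy hcase
    set Ky : Subfield Ω := Subfield.closure ((K : Set Ω) ∪ {y}) with hKydef
    set L : Subfield Ω := henselization V Ky with hLdef
    have hKKy : K ≤ Ky := fun c hc => Subfield.subset_closure (Or.inl hc)
    have hyKy : y ∈ Ky := Subfield.subset_closure (Or.inr rfl)
    have hKyF : Ky ≤ F :=
      Subfield.closure_le.mpr (Set.union_subset hKF (Set.singleton_subset_iff.mpr hyF))
    have hKyL : Ky ≤ L := le_henselization V Ky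
    have hKL : K ≤ L := hKKy.trans hKyL
    have hL : IsHenselianField L (V.comap (algebraMap L Ω)) :=
      Kuhlmann2010HenselizationIsHenselian_holds Ω V Ky
    have himmL : IsImmediateOver V Ky L := Kuhlmann2010HenselizationImmediate_holds Ω V Ky
    -- `x` is separable over `L`
    have hsepKy : IsSeparable Ky x :=
      isSeparable_trans_subfield hKyF hsepy (isSeparable_of_mem_henselization V F hxFh)
    have hsepL : IsSeparable L x := isSeparable_of_subfield_le hKyL hsepKy
    -- `x` is a limit of elements of `L`
    have happrox : ∀ e' ∈ L, e' ≠ 0 → ∃ ℓ ∈ L, V.valuation (x - ℓ) < V.valuation e' := by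
      intro e' he'L he'0
      -- `e₁ ∈ K^×` with `v(e₁) = v(e')`
      obtain ⟨e₂, he₂Ky, he₂⟩ := himmL.1 e' he'L he'0
      have he₂0 : e₂ ≠ 0 := fun h => he'0 (by
        rw [h, map_zero] at he₂; exact (Valuation.zero_iff _).mp he₂)
      obtain ⟨e₁, he₁K, he₁⟩ := himm.1 e₂ (hKyF he₂Ky) he₂0
      have he₁0 : e₁ ≠ 0 := fun h => he₂0 (by
        rw [h, map_zero] at he₁; exact (Valuation.zero_iff _).mp he₁)
      rw [he₂, he₁]
      rcases hcase with hA | ⟨e, heK, he0, hefar, hey⟩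
      · obtain ⟨c, hcK, hc⟩ := hA e₁ he₁K he₁0
        exact ⟨c, hKL hcK, hc⟩
      · -- the Newton step: approximate `y` by `f(x)`, `f ∈ K[X]`, to within `min(v e, v e₁)`
        obtain ⟨d, hdK, hd0, hde, hde₁⟩ : ∃ d ∈ K, d ≠ 0 ∧ V.valuation d ≤ V.valuation e ∧
            V.valuation d ≤ V.valuation e₁ := by
          by_cases h : V.valuation e₁ ≤ V.valuation e
          · exact ⟨e₁, he₁K, he₁0, h, le_rfl⟩
          · exact ⟨e, heK, he0, le_rfl, (not_le.mp h).le⟩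
        obtain ⟨f, hf, hfy⟩ := exists_polynomial_valuation_sub_lt_of_mem_henselization V K hxK
          hval hres h3 hr1Kx (hFx hyF) (hKKx hdK) hd0
        have hy' : ∀ c ∈ K, V.valuation (x - y) < V.valuation (x - c) := fun c hc =>
          lt_of_lt_of_le hey (hefar c hc)
        have hfy' : ∀ c ∈ K, V.valuation (f.eval x - y) < V.valuation (x - c) := fun c hc => by
          rw [Valuation.map_sub_swap]
          exact lt_of_lt_of_le hfy (hde.trans (hefar c hc))
        obtain ⟨ℓ, hℓL, hℓ⟩ := exists_mem_valuation_sub_le_of_taylor V K hxK hval hres h3 hL hKL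
          (hKyL hyKy) hy' hf hfy'
        refine ⟨ℓ, hℓL, lt_of_le_of_lt hℓ ?_⟩
        rw [Valuation.map_sub_swap]
        exact lt_of_lt_of_le hfy hde₁
    -- Krasner: `x ∈ L`; hence `K(x)^h ≤ L` and `F ≤ L`
    have hxL : x ∈ L := mem_of_isHenselianField_of_forall_exists_valuation_sub_lt V hL hsepL happrox
    have hKxL : Kx ≤ L :=
      Subfield.closure_le.mpr (Set.union_subset hKL (Set.singleton_subset_iff.mpr hxL))
    have hHxL : Hx ≤ L := henselization_le_of_isHenselianField V Kx hKxL hL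
    exact hFx.trans hHxL
  /- Case distinction: is `x` a limit of elements of `K`? -/
  by_cases hA : ∀ e ∈ K, e ≠ 0 → ∃ c ∈ K, V.valuation (x - c) < V.valuation e
  · exact ⟨z, hzF, hz, core z hzF hz hsepz (Or.inl hA)⟩
  push Not at hA
  obtain ⟨e, heK, he0, hefar⟩ := hA
  -- `y₀ ∈ F` close to `x` (density of `F` in `F^h`) and a small separating `z₁ = a z`
  obtain ⟨y₀, hy₀F, hy₀⟩ := exists_mem_valuation_sub_lt_of_isRankOneValued hFr hxFh (hKF heK) he0
  have hz0 : z ≠ 0 := fun h => hz (h ▸ isAlgebraic_zero)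
  obtain ⟨z', hz'K, hzz'⟩ := himm.1 z hzF hz0
  have hz'0 : z' ≠ 0 := fun h => hz0 (by
    rw [h, map_zero] at hzz'; exact (Valuation.zero_iff _).mp hzz')
  set a : Ω := e * z'⁻¹ * π with hadef
  have haK : a ∈ K := mul_mem (mul_mem heK (inv_mem hz'K)) hπK
  have ha0 : a ≠ 0 := mul_ne_zero (mul_ne_zero he0 (inv_ne_zero hz'0)) hπ0
  set z₁ : Ω := a * z with hz₁def
  have hz₁F : z₁ ∈ F := mul_mem (hKF haK) hzF
  have hvz₁ : V.valuation z₁ < V.valuation e := by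
    have hvz' : V.valuation z' ≠ 0 := (_root_.map_ne_zero _).mpr hz'0
    have : V.valuation z₁ = V.valuation e * V.valuation π := by
      rw [hz₁def, hadef, map_mul, map_mul, map_mul, map_inv₀, hzz']
      field_simp
    rw [this]
    calc V.valuation e * V.valuation π < V.valuation e * 1 :=
          mul_lt_mul_of_pos_left hπ1 ((Valuation.pos_iff _).mpr he0)
      _ = V.valuation e := mul_one _
  have hz₁ : Transcendental K z₁ := by
    refine transcendental_of_mem_closure K hz ?_ fun hz₁K => ?_
    · exact mul_mem (Subfield.subset_closure (Or.inl haK)) (Subfield.subset_closure (Or.inr rfl))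
    · have hzK : z ∈ K := by
        have : z = a⁻¹ * z₁ := by rw [hz₁def, ← mul_assoc, inv_mul_cancel₀ ha0, one_mul]
        rw [this]; exact mul_mem (inv_mem haK) hz₁K
      exact hz (isAlgebraic_algebraMap (⟨z, hzK⟩ : K))
  have hsepz₁ : ∀ b ∈ F, IsSeparable (Subfield.closure ((K : Set Ω) ∪ {z₁})) b := by
    rw [hz₁def, closure_insert_mul_eq K haK ha0 z]
    exact hsepz
  -- both candidates `y₀`, `y₀ + z₁` are within `v(e)` of `x`, hence transcendental
  have hy₁ : V.valuation (x - (y₀ + z₁)) < V.valuation e := by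
    have : x - (y₀ + z₁) = (x - y₀) + -z₁ := by ring
    rw [this]
    refine lt_of_le_of_lt (Valuation.map_add _ _ _) (max_lt hy₀ ?_)
    rw [Valuation.map_neg]; exact hvz₁
  have hfar₀ : ∀ c ∈ K, V.valuation (x - y₀) < V.valuation (x - c) := fun c hc =>
    lt_of_lt_of_le hy₀ (hefar c hc)
  have hfar₁ : ∀ c ∈ K, V.valuation (x - (y₀ + z₁)) < V.valuation (x - c) := fun c hc =>
    lt_of_lt_of_le hy₁ (hefar c hc)
  -- (an algebraic element of `F` closer to `x` than `K` would lie in `K`: splitness)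
  have htr : ∀ y ∈ F, (∀ c ∈ K, V.valuation (x - y) < V.valuation (x - c)) → Transcendental K y :=
    fun y hyF hfar' hyalg => lt_irrefl _ (hfar' y (hrel y (hFFh hyF) hyalg))
  have hy₀t : Transcendental K y₀ := htr y₀ hy₀F hfar₀
  have hy₁t : Transcendental K (y₀ + z₁) := htr (y₀ + z₁) (add_mem hy₀F hz₁F) hfar₁
  -- one of them is separating
  have hsep_or : (∀ w ∈ F, IsSeparable (Subfield.closure ((K : Set Ω) ∪ {y₀})) w) ∨
      (∀ w ∈ F, IsSeparable (Subfield.closure ((K : Set Ω) ∪ {y₀ + z₁})) w) := by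
    obtain ⟨p, hcharp⟩ := CharP.exists Ω
    by_cases hp0 : p = 0
    · -- characteristic `0`: every transcendental element over which `F` is algebraic separates
      subst hp0
      haveI : CharZero Ω := CharP.charP_to_charZero Ω
      left
      intro w hw
      have halgz : ∀ b ∈ F, IsAlgebraic (Subfield.closure ((K : Set Ω) ∪ {z})) b :=
        fun b hb => (hsepz b hb).isIntegral.isAlgebraic
      have halg₀ := isAlgebraic_closure_of_transcendental halgz hy₀F hy₀t
      have hint := (halg₀ w hw).isIntegral
      haveI : CharZero (Subfield.closure ((K : Set Ω) ∪ {y₀})) :=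
        (Subfield.closure ((K : Set Ω) ∪ {y₀})).subtype.charZero
      exact PerfectField.separable_of_irreducible (minpoly.irreducible hint)
    · haveI : Fact p.Prime := ⟨CharP.char_prime_of_ne_zero Ω hp0⟩
      exact separating_or_separating_add p hKF hfg hz₁ hz₁F hsepz₁ hy₀F hy₀t hy₁t
  rcases hsep_or with hsep₀ | hsep₁
  · exact ⟨y₀, hy₀F, hy₀t, core y₀ hy₀F hy₀t hsep₀ (Or.inr ⟨e, heK, he0, hefar, hy₀⟩)⟩
  · exact ⟨y₀ + z₁, add_mem hy₀F hz₁F, hy₁t,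
      core (y₀ + z₁) (add_mem hy₀F hz₁F) hy₁t hsep₁ (Or.inr ⟨e, heK, he0, hefar, hy₁⟩)⟩


end KV

/-! ### Henselian rationality -/

section Main

/-- **Henselian rationality over a perfect henselian ground field of rank one without tame
extensions, for function fields in which the ground field is algebraically closed** — the
valuation-theoretic content of Temkin 2013, Thm. 3.2.3 in the case "`K` is `k`-split and
`k = k^{mr}`" ("Our starting point is [temst], which implies that the Theorem holds when `K` is
`k`-split and `k = k^{mr}`. Clearly, `K = \overline{k(T)}` in this case"; [temst] = M. Temkin,
*Stable modification of relative curves*, J. Algebraic Geom. 19 (2010), Thm. 6.3.1), in the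
architecture of Kuhlmann 2019, Prop. 5.2 (there: `K` separably closed). Let `Ω` be
algebraically closed of characteristic `p` with valuation ring `V` (residue characteristic `p`),
`K ≤ Ω` perfect, henselian, of rank one (`IsRankOne`), with divisible value group (every value
of `K^×` an `n`-th power of a value of `K^×`, `n ≥ 1`) and algebraically closed residue field —
i.e. `K` admits no proper tame extension —, `F ≥ K` finitely and separably generated of
transcendence degree `1`, `(F|K, V)` immediate, and assume that every element of `F^h` algebraic
over `K` lies in `K` (`F^h` is `K`-split, Cor. 3.1.10). Then `(F|K, V)` is HENSELIAN RATIONAL: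
`F ≤ K(x)^h` for some `x ∈ F` transcendental over `K`. PROVED along the printed proof of
Prop. 5.2: a separating `y` (Lemma 5.4, `Kuhlmann2019_Lemma54_holds`), `E = F.K(y)^h` is a tower
of Galois steps of degree `p` over `K(y)^h` (Lemma 5.1, `isNormalPTower_of_isSeparable_of_divisible`
— this is where "no tame extensions" enters), each step is henselized rational
(`prop48_of_perfect`, `Kuhlmann2019DegreePStepSplit.lean` — this is where splitness and
perfectness replace separable closedness), induction (`exists_eq_henselization_of_isNormalPTower_of_le`),
and the generator is moved into `F` (`kuhlmannVlahu_thm111_of_perfect`).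
[cite: Kuhlmann2019, Prop. 5.2] [cite: Temkin2013, Thm. 3.2.3] -/
theorem henselianRational_of_perfect_of_forall_isAlgebraic_mem [IsAlgClosed Ω] (p : ℕ)
    [Fact p.Prime] [CharP Ω p] [CharP (ResidueField V) p] (K F : Subfield Ω)
    (hK : IsHenselianField K (V.comap (algebraMap K Ω))) (hperf : ∀ y ∈ K, ∃ b ∈ K, b ^ p = y)
    (hr : IsRankOne V K)
    (hdiv : ∀ b ∈ K, b ≠ 0 → ∀ n : ℕ, n ≠ 0 → ∃ a ∈ K, V.valuation (a ^ n) = V.valuation b)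
    (hres : IsAlgClosed (resField V K))
    (hKF : K ≤ F) (hfg : FGOver K F) (hsg : SeparablyGeneratedOver K F)
    (h1 : ∃ t ∈ F, Transcendental K t ∧
      ∀ z ∈ F, IsAlgebraic (IntermediateField.adjoin K ({t} : Set Ω)) z)
    (himm : IsImmediateOver V K F)
    (hrel : ∀ a ∈ henselization V F, IsAlgebraic K a → a ∈ K) :
    ∃ x ∈ F, Transcendental K x ∧ F ≤ henselization V (Subfield.closure ((K : Set Ω) ∪ {x})) := by
  classical
  have hp : p.Prime := Fact.out
  -- `v` is non-trivial on `K` (rank one)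
  have hnt : ∃ a ∈ K, a ∉ V := by
    by_contra hall
    push Not at hall
    apply hr.1
    ext c
    simp only [ValuationSubring.mem_comap, ValuationSubring.mem_top, iff_true]
    exact hall c c.2
  obtain ⟨t, htF, ht, halg⟩ := h1
  -- a separating element `y ∈ F` (Lemma 5.4); it is transcendental over `K`
  have hntF : ∃ a ∈ F, a ≠ 0 ∧ V.valuation a ≠ 1 := by
    obtain ⟨a, haK, haV⟩ := hnt
    refine ⟨a, hKF haK, fun h0 => haV (h0 ▸ V.zero_mem), fun h1 => haV ?_⟩
    exact (V.valuation_le_one_iff a).mp h1.le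
  have ht0 : t ≠ 0 := fun h0 => ht (h0 ▸ isAlgebraic_zero)
  obtain ⟨y, hyF, hysep, -, -⟩ :=
    Kuhlmann2019_Lemma54_holds Ω V K F hKF hfg hsg ⟨t, htF, ht, halg⟩ hntF t htF ht0
  have hy : Transcendental K y := by
    intro hyalg
    apply ht
    haveI : FiniteDimensional K (IntermediateField.adjoin K ({y} : Set Ω)) :=
      IntermediateField.adjoin.finiteDimensional hyalg.isIntegral
    haveI : Algebra.IsIntegral K (IntermediateField.adjoin K ({y} : Set Ω)) :=
      Algebra.IsIntegral.of_finite K _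
    exact (isIntegral_trans (R := K) (A := IntermediateField.adjoin K ({y} : Set Ω)) t
      (hysep t htF).isIntegral).isAlgebraic
  -- `K(y)`, its henselization `L = K(y)^h`, `F^h`, and `E = F.L`
  set Ky : Subfield Ω := Subfield.closure ((K : Set Ω) ∪ {y}) with hKydef
  set L : Subfield Ω := henselization V Ky with hLdef
  have hKKy : K ≤ Ky := fun c hc => Subfield.subset_closure (Or.inl hc)
  have hKyF : Ky ≤ F :=
    Subfield.closure_le.mpr (Set.union_subset hKF (Set.singleton_subset_iff.mpr hyF))
  have hKyL : Ky ≤ L := le_henselization V Ky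
  have himmKy : IsImmediateOver V K Ky := himm.mono_right hKyF
  set Fh : Subfield Ω := henselization V F with hFhdef
  have himmFh : IsImmediateOver V K Fh :=
    himm.trans (Kuhlmann2010HenselizationImmediate_holds Ω V F)
  have hFhh : IsHenselianField Fh (V.comap (algebraMap Fh Ω)) :=
    Kuhlmann2010HenselizationIsHenselian_holds Ω V F
  have hLFh : L ≤ Fh := henselization_mono V Kuhlmann2010HenselizationIsHenselian_holds hKyF
  have hFFh : F ≤ Fh := le_henselization V F
  obtain ⟨s, hs⟩ := hfg
  set E : Subfield Ω := Subfield.closure ((L : Set Ω) ∪ s) with hEdef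
  have hsF : (s : Set Ω) ⊆ F := fun a ha => hs ▸ Subfield.subset_closure (Or.inr ha)
  have hLE : L ≤ E := fun c hc => Subfield.subset_closure (Or.inl hc)
  have hFE : F ≤ E := by
    rw [← hs]
    exact Subfield.closure_mono (Set.union_subset_union_left _ (hKKy.trans hKyL))
  have hEFh : E ≤ Fh := Subfield.closure_le.mpr (Set.union_subset hLFh (hsF.trans hFFh))
  -- `E|L` is finite and separable
  have hsepL : ∀ a ∈ (s : Set Ω), IsSeparable L a := fun a ha =>
    isSeparable_of_subfield_le hKyL ((isSeparable_closure_iff K {y} a).mpr (hysep a (hsF ha)))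
  have hsepE : ∀ z ∈ E, IsSeparable L z := fun z hz => isSeparable_of_mem_closure hsepL hz
  have hpos : 0 < Subfield.relfinrank L E :=
    relfinrank_closure_pos L s fun a ha => (hsepL a (Finset.mem_coe.mpr ha)).isIntegral
  -- Lemma 5.1: `E` is reached from `L` by normal steps of degree `p` (no tame extensions)
  have hL : IsHenselianField L (V.comap (algebraMap L Ω)) :=
    Kuhlmann2010HenselizationIsHenselian_holds Ω V Ky
  have himmL : IsImmediateOver V K L :=
    himmKy.trans (Kuhlmann2010HenselizationImmediate_holds Ω V Ky)
  have hKL : K ≤ L := hKKy.trans hKyL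
  have hdivL : ∀ b ∈ L, b ≠ 0 → ∀ n : ℕ, n ≠ 0 → ∃ a ∈ L, V.valuation (a ^ n) = V.valuation b := by
    intro b hbL hb0 n hn0
    obtain ⟨c, hcK, hbc⟩ := himmL.1 b hbL hb0
    have hc0 : c ≠ 0 := by
      rintro rfl
      rw [map_zero, map_eq_zero] at hbc
      exact hb0 hbc
    obtain ⟨a, haK, ha⟩ := hdiv c hcK hc0 n hn0
    exact ⟨a, hKL haK, ha.trans hbc.symm⟩
  have hresL : IsAlgClosed (resField V L) := by
    have hres' : resField V L = resField V K := le_antisymm himmL.2 (resField_mono V hKL)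
    rw [hres']
    exact hres
  have htower : IsNormalPTower p L E :=
    isNormalPTower_of_isSeparable_of_divisible V hp hL hdivL hresL hLE hpos hsepE
  -- the induction along the tower, with the degree-`p` step `prop48_of_perfect` inside `F^h`
  obtain ⟨y₁, hy₁E, hy₁, hE⟩ := exists_eq_henselization_of_isNormalPTower_of_le V
    (fun y' E' hy' himm' hy'Φ hgal' hE'Φ =>
      prop48_of_perfect V p K hK hperf hr hy' himm' hFhh hy'Φ (hKF.trans hFFh) hrel hgal' hE'Φ)
    himmFh htower y hy (hFFh hyF) rfl hEFh hsepE
  -- [23, Thm. 11.1]: the generator can be taken in `F`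
  have hFle : F ≤ henselization V (Subfield.closure ((K : Set Ω) ∪ {y₁})) := hE ▸ hFE
  exact kuhlmannVlahu_thm111_of_perfect V p K F y₁ hK hperf hr hKF ⟨s, hs⟩ hsg ⟨t, htF, ht, halg⟩
    himm hrel (hEFh hy₁E) hy₁ hFle

end Main

end Literature.AlgebraicGeometry.Resolution
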